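import Literature.NumberTheory.IwasawaTheory.ClassicalMuVanishesCommutatorPrimePowerOfFerreroWashington
import HarnessLib

/-!
# `μ₃ = 0` for EVERY cubic number field (cyclic or `S₃`) and every cyclotomic `ℤ₃`-extension — granted Ferrero–Washington
# (Iwasawa 1973 over the quadratic resolvent + finite descent; proved glue, no new definition, no new named fact)

`Proofs`-style file (theorems only, no `sorry`) in topic `NumberTheory/IwasawaTheory` (namespace `Literature.NumberTheory.IwasawaTheory`),
written by the prover seat `bsd-line-att-p3` g37 (cell `bsd-f1-sign2`; sequel of `ClassicalMuVanishesCommutatorPrimePowerOfFerreroWashington`;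
`--supports` stmt-BirchSwinnertonDyer-22298 as the `p = 3` contrast statement for the crux's `S₃` carriers; closes nothing; nothing about
elliptic curves or BSD is asserted).

THE THEOREM (`classicalMuVanishes_of_finrank_eq_three_of_ferreroWashington`).  `K` a number field with `[K : ℚ] = 3`, `κ` a cyclotomic
`ℤ₃`-extension of `K`: GRANTED the Ferrero–Washington theorem (tree named fact `ferreroWashington1979_classicalMuVanishes`), `ClassicalMuVanishes κ`
(`μ₃ = 0` in growth form).  Route: the Galois closure `N` of `K` in `ℚ̄` has a group `G` embedding in the permutations of the three embeddings
`K → N`, so `#G ∣ 6` and (§1, Sylow) `#[G, G] ∣ 3`; the prequel's envelope theorem (`[G, G]` of `3`-power order: Ferrero–Washington on the maximal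
abelian subfield of `N(i)`, Iwasawa 1973 Thm. 3, finite descent) gives `μ₃ = 0` on `N` and on `K ⊆ N`.  For an `S₃`-cubic this is «`μ₃` of the
quadratic resolvent `k` vanishes (Ferrero–Washington) ⟹ `μ₃` of the `S₃`-closure `L ⊇ k`, `[L : k] = 3` Galois (Iwasawa) ⟹ `μ₃(K) = 0` (descent)».

CONTRAST (crux C2 `MainConjectureOfRankZeroBSDAtTwo`): the SAME `S₃`-cubics `ℚ(β)` (`β` a `2`-torsion abscissa) carry the crux's open input at
`p = 2`, where `[S₃, S₃] = C₃` is not a `2`-group and no envelope applies — Iwasawa's `μ₂`-conjecture for complex / totally real `S₃`-cubics is open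
in print.  Nothing here moves C2.

* §1 [folklore], PRIVATE: a finite group of order dividing `6` has commutator subgroup of order dividing `3` (its Sylow `3`-subgroup is normal with
  quotient of order `≤ 2`); the automorphism group of the normal closure of a cubic field has order dividing `6`.
* §2 ★★ `classicalMuVanishes_of_finrank_eq_three_of_ferreroWashington`; `classicalMuVanishes_normalClosure_of_finrank_eq_three_of_ferreroWashington`
  (the Galois closure itself: the cyclic cubic, or the `S₃`-sextic).

References: [Iwasawa1973MuInvariants] Thm. 3, §3 (remark after Thm. 2), §4; [FerreroWashington1979] main theorem; [Washington1997] §7.5, §13.3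
Prop. 13.23.
-/

set_option autoImplicit false

noncomputable section

open scoped NumberField Classical IntermediateField
open NumberField Field IntermediateField IsDedekindDomain Module Polynomial

namespace Literature.NumberTheory.IwasawaTheory

open Literature.NumberTheory.EllipticCurves Literature.NumberTheory.EllipticCurves.ZpExtension
  Literature.NumberTheory.GaloisRepresentations Literature.NumberTheory.NumberFields

/-! ## §1 Glue -/

/-- A finite group of order dividing `6` has commutator subgroup of order dividing `3` (the Sylow `3`-subgroup is normal — `n₃ ≡ 1 (mod 3)`,
`n₃ ∣ 6` — and the quotient, of order dividing `2`, is commutative). [folklore] -/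
private theorem card_commutator_dvd_three_of_card_dvd_six {G : Type*} [Group G] [Finite G] (hG : Nat.card G ∣ 6) :
    Nat.card (commutator G) ∣ 3 := by
  haveI : Fact (Nat.Prime 3) := ⟨Nat.prime_three⟩
  obtain ⟨P⟩ : Nonempty (Sylow 3 G) := inferInstance
  -- `#P ∣ 3`
  obtain ⟨k, hk⟩ := P.isPGroup'.exists_card_eq
  have hPdvd : Nat.card (P : Subgroup G) ∣ 6 := (Subgroup.card_subgroup_dvd_card (P : Subgroup G)).trans hG
  have hP3 : Nat.card (P : Subgroup G) ∣ 3 := by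
    rw [hk] at hPdvd ⊢
    have hk1 : k ≤ 1 := by
      by_contra h
      have h9 : 3 ^ 2 ∣ 3 ^ k := pow_dvd_pow 3 (by omega)
      have : 9 ∣ 6 := (by norm_num : (9 : ℕ) = 3 ^ 2) ▸ h9.trans hPdvd
      omega
    interval_cases k <;> norm_num
  -- `n₃ = 1`: `P` is normal
  have hn : Nat.card (Sylow 3 G) = 1 := by
    have h1 : Nat.card (Sylow 3 G) ≡ 1 [MOD 3] := card_sylow_modEq_one 3 G
    have h2 : Nat.card (Sylow 3 G) ∣ 6 :=
      (Sylow.card_dvd_index P).trans ((Subgroup.index_dvd_card (P : Subgroup G)).trans hG)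
    have h3 : Nat.card (Sylow 3 G) ≤ 6 := Nat.le_of_dvd (by norm_num) h2
    interval_cases h : Nat.card (Sylow 3 G) <;> simp_all (config := {decide := true})
  haveI : Subsingleton (Sylow 3 G) := (Finite.card_le_one_iff_subsingleton).mp hn.le
  haveI hPn : (P : Subgroup G).Normal := P.normal_of_subsingleton
  -- the quotient has order dividing `2`, hence is commutative
  have hidx6 : (P : Subgroup G).index ∣ 6 := (Subgroup.index_dvd_card (P : Subgroup G)).trans hG
  have hidx3 : ¬ 3 ∣ (P : Subgroup G).index := P.not_dvd_index
  have hidx : (P : Subgroup G).index ∣ 2 := by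
    have h6 : (P : Subgroup G).index ≤ 6 := Nat.le_of_dvd (by norm_num) hidx6
    interval_cases h : (P : Subgroup G).index <;> simp_all (config := {decide := true})
  have hcyc : IsCyclic (G ⧸ (P : Subgroup G)) := by
    have hcard : Nat.card (G ⧸ (P : Subgroup G)) ∣ 2 := by rwa [← Subgroup.index_eq_card]
    rcases (Nat.dvd_prime Nat.prime_two).mp hcard with h | h
    · haveI : Subsingleton (G ⧸ (P : Subgroup G)) := (Finite.card_le_one_iff_subsingleton).mp h.le
      exact isCyclic_of_subsingleton
    · haveI : Fact (Nat.Prime 2) := ⟨Nat.prime_two⟩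
      exact isCyclic_of_prime_card h
  have hcomm : ∀ a b : G ⧸ (P : Subgroup G), a * b = b * a := fun a b =>
    (IsCyclic.commGroup (α := G ⧸ (P : Subgroup G))).mul_comm a b
  -- `[G, G] ≤ P`
  have hle : commutator G ≤ (P : Subgroup G) := by
    rw [commutator_def, Subgroup.commutator_le]
    intro a _ b _
    rw [← QuotientGroup.eq_one_iff, ← QuotientGroup.mk'_apply, map_commutatorElement, commutatorElement_eq_one_iff_commute]
    exact hcomm _ _
  exact (Subgroup.card_dvd_of_le hle).trans hP3

/-- `ℚ̄ = AlgebraicClosure ℚ` is a normal extension of `ℚ` for the AMBIENT `ℚ`-algebra structure (Mathlib's `IsAlgClosure` instance is keyed on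
`AlgebraicClosure.instAlgebra`, which agrees with the `ℚ`-algebra structure found by instance search only propositionally — `Subsingleton (Algebra ℚ _)`).
[folklore] -/
private theorem normal_rat_algebraicClosure : Normal ℚ (AlgebraicClosure ℚ) := by
  haveI : Algebra.IsAlgebraic ℚ (AlgebraicClosure ℚ) := by
    refine ⟨fun x => ?_⟩
    obtain ⟨q, hq, hqx⟩ := (AlgebraicClosure.isAlgebraic ℚ).isAlgebraic x
    refine ⟨q, hq, ?_⟩
    rw [Polynomial.aeval_def] at hqx ⊢
    rwa [Subsingleton.elim (algebraMap ℚ (AlgebraicClosure ℚ))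
      (@algebraMap ℚ (AlgebraicClosure ℚ) _ _ (AlgebraicClosure.instAlgebra ℚ))]
  exact ⟨fun x => IsAlgClosed.splits _⟩

/-- The automorphism group of the normal closure `N ⊆ ℚ̄` of a cubic number field `K` has order dividing `6 = 3!`: it acts faithfully on the
three `ℚ`-embeddings `K → N`. [folklore] -/
private theorem card_aut_normalClosure_dvd_six (K : Type) [Field K] [NumberField K] (hK : Module.finrank ℚ K = 3) :
    Nat.card (↥(normalClosure ℚ K (AlgebraicClosure ℚ)) ≃ₐ[ℚ] ↥(normalClosure ℚ K (AlgebraicClosure ℚ))) ∣ 6 := by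
  -- the three embeddings `K → N`
  have hX : Nat.card (K →ₐ[ℚ] ↥(normalClosure ℚ K (AlgebraicClosure ℚ))) = 3 :=
    (Nat.card_congr (normalClosure.algHomEquiv (F := ℚ) (K := K) (L := AlgebraicClosure ℚ))).trans
      (by rw [Nat.card_eq_fintype_card, AlgHom.card, hK])
  haveI : Finite (K →ₐ[ℚ] ↥(normalClosure ℚ K (AlgebraicClosure ℚ))) := Nat.finite_of_card_ne_zero (by rw [hX]; norm_num)
  -- the action of `Gal(N/ℚ)` by composition
  letI : MulAction (↥(normalClosure ℚ K (AlgebraicClosure ℚ)) ≃ₐ[ℚ] ↥(normalClosure ℚ K (AlgebraicClosure ℚ)))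
      (K →ₐ[ℚ] ↥(normalClosure ℚ K (AlgebraicClosure ℚ))) :=
    { smul := fun σ φ => (σ : ↥(normalClosure ℚ K (AlgebraicClosure ℚ)) →ₐ[ℚ] ↥(normalClosure ℚ K (AlgebraicClosure ℚ))).comp φ
      one_smul := fun φ => AlgHom.ext fun _ => rfl
      mul_smul := fun _ _ _ => AlgHom.ext fun _ => rfl }
  let τ : (↥(normalClosure ℚ K (AlgebraicClosure ℚ)) ≃ₐ[ℚ] ↥(normalClosure ℚ K (AlgebraicClosure ℚ))) →*
      Equiv.Perm (K →ₐ[ℚ] ↥(normalClosure ℚ K (AlgebraicClosure ℚ))) :=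
    MulAction.toPermHom _ _
  have hτ : Function.Injective τ := by
    rw [injective_iff_map_eq_one]
    intro σ hσ
    have hfix : ∀ φ : K →ₐ[ℚ] ↥(normalClosure ℚ K (AlgebraicClosure ℚ)),
        (σ : ↥(normalClosure ℚ K (AlgebraicClosure ℚ)) →ₐ[ℚ] ↥(normalClosure ℚ K (AlgebraicClosure ℚ))).comp φ = φ :=
      fun φ => Equiv.ext_iff.mp hσ φ
    -- `σ` fixes the generators `f(K)`, `f : K → ℚ̄`, of `N`
    have hNadj : normalClosure ℚ K (AlgebraicClosure ℚ) =
        IntermediateField.adjoin ℚ (⋃ f : K →ₐ[ℚ] AlgebraicClosure ℚ, (f.fieldRange : Set (AlgebraicClosure ℚ))) := by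
      rw [normalClosure_def, IntermediateField.iSup_eq_adjoin]
    have key : (σ : ↥(normalClosure ℚ K (AlgebraicClosure ℚ)) →ₐ[ℚ] ↥(normalClosure ℚ K (AlgebraicClosure ℚ))) = AlgHom.id ℚ _ := by
      refine IntermediateField.algHom_ext_of_eq_adjoin ℚ hNadj fun x hx => ?_
      obtain ⟨f, hxf⟩ := Set.mem_iUnion.mp hx
      obtain ⟨k, rfl⟩ := (AlgHom.mem_fieldRange).mp hxf
      let φ : K →ₐ[ℚ] ↥(normalClosure ℚ K (AlgebraicClosure ℚ)) :=
        (normalClosure.algHomEquiv (F := ℚ) (K := K) (L := AlgebraicClosure ℚ)).symm f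
      have hφk : ((φ k : ↥(normalClosure ℚ K (AlgebraicClosure ℚ))) : AlgebraicClosure ℚ) = f k := rfl
      have h1 : σ (φ k) = φ k := congrArg (fun ψ : K →ₐ[ℚ] ↥(normalClosure ℚ K (AlgebraicClosure ℚ)) => ψ k) (hfix φ)
      have h2 : (⟨f k, hNadj.ge (IntermediateField.subset_adjoin _ _ hx)⟩ : ↥(normalClosure ℚ K (AlgebraicClosure ℚ))) = φ k :=
        Subtype.ext hφk.symm
      change σ ⟨f k, _⟩ = ⟨f k, _⟩
      rw [h2, h1]
    ext x
    simpa using congrArg (fun ψ => ψ x) key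
  have hperm : Nat.card (Equiv.Perm (K →ₐ[ℚ] ↥(normalClosure ℚ K (AlgebraicClosure ℚ)))) = 6 := by
    rw [Nat.card_perm, hX]; rfl
  exact hperm ▸ Subgroup.card_dvd_of_injective τ hτ

/-! ## §2 Cubic fields at `p = 3` -/

/-- ★★ **`μ₃ = 0` on the Galois closure of every cubic number field, GRANTED Ferrero–Washington**: for `K` with `[K : ℚ] = 3` and
`N = ` its normal closure in `ℚ̄` (the cyclic cubic itself, or the `S₃`-sextic), every cyclotomic `ℤ₃`-extension of `N` has `ClassicalMuVanishes`
(`#Gal(N/ℚ) ∣ 6` ⟹ `#[G, G] ∣ 3`; envelope theorem of the prequel at `p = 3`). [cite: Iwasawa1973MuInvariants, Thm. 3, §3 (remark after Thm. 2), §4]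
[cite: FerreroWashington1979, main theorem] -/
theorem classicalMuVanishes_normalClosure_of_finrank_eq_three_of_ferreroWashington (hFW : ferreroWashington1979_classicalMuVanishes)
    (K : Type) [Field K] [NumberField K] (hK : Module.finrank ℚ K = 3)
    (κN : ZpExtension ↥(normalClosure ℚ K (AlgebraicClosure ℚ)) 3) (hκN : κN.IsCyclotomic) : ClassicalMuVanishes κN := by
  haveI : Fact (Nat.Prime 3) := ⟨Nat.prime_three⟩
  haveI : FiniteDimensional ℚ ↥(normalClosure ℚ K (AlgebraicClosure ℚ)) := inferInstance
  haveI : NumberField ↥(normalClosure ℚ K (AlgebraicClosure ℚ)) := NumberField.of_module_finite ℚ _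
  haveI : Normal ℚ (AlgebraicClosure ℚ) := normal_rat_algebraicClosure
  haveI : Normal ℚ ↥(normalClosure ℚ K (AlgebraicClosure ℚ)) := normalClosure.normal ℚ K (AlgebraicClosure ℚ)
  haveI : IsGalois ℚ ↥(normalClosure ℚ K (AlgebraicClosure ℚ)) := ⟨⟩
  have h6 := card_aut_normalClosure_dvd_six K hK
  have h3 := card_commutator_dvd_three_of_card_dvd_six h6
  obtain ⟨m, hm⟩ : ∃ m : ℕ, Nat.card (commutator (↥(normalClosure ℚ K (AlgebraicClosure ℚ)) ≃ₐ[ℚ]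
      ↥(normalClosure ℚ K (AlgebraicClosure ℚ)))) = 3 ^ m := by
    rcases (Nat.dvd_prime Nat.prime_three).mp h3 with h | h
    · exact ⟨0, by rw [h, pow_zero]⟩
    · exact ⟨1, by rw [h, pow_one]⟩
  exact classicalMuVanishes_of_isGalois_rat_of_card_commutator_eq_prime_pow_of_ferreroWashington hFW 3 _ m hm κN hκN

/-- ★★ **`μ₃ = 0` for EVERY cubic number field, GRANTED Ferrero–Washington**: `[K : ℚ] = 3`, `κ` any cyclotomic `ℤ₃`-extension of `K` ⟹
`ClassicalMuVanishes κ` (growth form `e_n = λ n + ν`, `n ≫ 0`).  Cyclic cubics: Ferrero–Washington itself; `S₃`-cubics: Ferrero–Washington on the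
quadratic resolvent, Iwasawa 1973 Thm. 3 up the Galois cubic step, descent from the sextic closure (all assembled by the prequel's envelope theorem,
`#[G, G] ∣ 3`).  The same fields at `p = 2` are the open carriers of crux C2 (`[S₃, S₃] = C₃` is not a `2`-group).
[cite: Iwasawa1973MuInvariants, Thm. 3, §3 (remark after Thm. 2), §4] [cite: FerreroWashington1979, main theorem] [cite: Washington1997, §13.3 Prop. 13.23] -/
theorem classicalMuVanishes_of_finrank_eq_three_of_ferreroWashington (hFW : ferreroWashington1979_classicalMuVanishes)
    (K : Type) [Field K] [NumberField K] (hK : Module.finrank ℚ K = 3) (κ : ZpExtension K 3) (hκ : κ.IsCyclotomic) :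
    ClassicalMuVanishes κ := by
  haveI : Fact (Nat.Prime 3) := ⟨Nat.prime_three⟩
  haveI : FiniteDimensional ℚ ↥(normalClosure ℚ K (AlgebraicClosure ℚ)) := inferInstance
  haveI : NumberField ↥(normalClosure ℚ K (AlgebraicClosure ℚ)) := NumberField.of_module_finite ℚ _
  -- `K ⊆ N` along the chosen embedding
  let φ : K →ₐ[ℚ] ↥(normalClosure ℚ K (AlgebraicClosure ℚ)) :=
    (normalClosure.algHomEquiv (F := ℚ) (K := K) (L := AlgebraicClosure ℚ)).symm (absEmbedding ℚ K)
  letI : Algebra K ↥(normalClosure ℚ K (AlgebraicClosure ℚ)) := φ.toRingHom.toAlgebra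
  exact classicalMuVanishes_of_isCyclotomic_of_finite_noGrowth κ hκ ↥(normalClosure ℚ K (AlgebraicClosure ℚ))
    (fun κN hκN ↦ classicalMuVanishes_normalClosure_of_finrank_eq_three_of_ferreroWashington hFW K hK κN hκN)

end Literature.NumberTheory.IwasawaTheory

end
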